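import Summits.QuantumFields.YangMills.Theorems.F4SubCurvatureDoorFibreDichotomyShellLFAnalytic
import Summits.QuantumFields.YangMills.Theorems.F4SubCurvatureDoorSmearedSlices
import Mathlib
import HarnessLib

/-!
# LINE g21-B «fibre dichotomy» (⟨stmt-QuantumFields-23125⟩) — Helmholtz equation for the shell transform (piece 2a of rung R-B4e)

For a shell measure `ν` of squared mass `s` (`IsShellMeasure ν s`: forward cone, `E² − |q⃗|² = s` a.e., Laplace-integrable) the symmetric one-sided
transform `lfEval ν x = ∫ e^{−|x₀|E} cos⟪q⃗, x⃗⟫ dν` solves `Σᵢ ∂ᵢ² (lfEval ν) = s · lfEval ν` at every point with `x₀ ≠ 0`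
(`helmholtz_lfEval`).  PROOF: the second directional derivatives along the coordinate lines are computed by dominated differentiation exactly as
in rung R-S2a `LaplacianMultiplier` (`iteratedFDeriv_two_eq_of_line`, `hasDerivAt_integral_pow_mul_exp_mul`, `hasDerivAt_integral_spatial`):
time gives `∫ E² e^{−|x₀|E} cos`, space gives `−∫ qⱼ² e^{−|x₀|E} cos`, and `E² − |q⃗|² = s` ν-a.e. closes the sum; `C²` at the point is
`contDiffAt_lfEval` (piece 1, analyticity off the mirror).

HONEST LABEL: helper toward ONE rung (R-B4e) of the OPEN line g21-B; B4, B5, ⟨23125⟩, ⟨23035⟩, R2d and the Yang–Mills mass gap remain OPEN; no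
summit is proved by a line.
-/

noncomputable section

open MeasureTheory Filter Topology Set Metric
open scoped BigOperators

namespace Summit.QuantumFields.YangMills.Theorems.F4SubCurvatureDoorShellLFHelmholtz

open Summit.QuantumFields.YangMills.Theorems.F4SubCurvatureDoorLaplaceFourierRegistered (E4 E3 timeSpace)
open Summit.QuantumFields.YangMills.Theorems.F4SubCurvatureDoorFibreDichotomyAxis (spacePart lfEval)
open Summit.QuantumFields.YangMills.Theorems.F4SubCurvatureDoorLaplacianMultiplierRegistered (iteratedFDeriv_two_eq_of_line
  timeSpace_apply_zero timeSpace_add_smul_zero timeSpace_add_smul_succ inner_add_smul_single hasDerivAt_integral_spatial)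
open Summit.QuantumFields.YangMills.Theorems.F4SubCurvatureDoorSmearedSlices (integrable_pow_mul_exp_mul
  hasDerivAt_integral_pow_mul_exp_mul)
open Summit.QuantumFields.YangMills.Theorems.F4SubCurvatureDoorShellLFAnalytic (massSq IsShellMeasure IsShellMeasure.ae_cone
  lfEval_timeSpace timeSpace_self contDiffAt_lfEval)

variable {ν : Measure (ℝ × E3)} {s : ℝ}

/-- A shell measure has no negative energies. -/
theorem neg_null_of_shell (h : IsShellMeasure ν s) : ν (Set.Iio (0 : ℝ) ×ˢ (Set.univ : Set E3)) = 0 := by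
  refine measure_mono_null (fun p hp => ?_) h.1
  simp only [Set.mem_prod, Set.mem_Iio, Set.mem_univ, and_true] at hp
  exact lt_of_lt_of_le hp (norm_nonneg _)

/-- On a shell measure, `E² − |q⃗|² = s` a.e. -/
theorem ae_massSq_of_shell (h : IsShellMeasure ν s) : ∀ᵐ p ∂ν, p.1 ^ 2 - ‖p.2‖ ^ 2 = s := by
  filter_upwards [measure_eq_zero_iff_ae_notMem.1 h.2.1] with p hp
  simpa [massSq] using hp

/-- The sign trick: near `t ≠ 0`, `|t + r| = |t| + σ r` with `σ = ±1`. -/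
theorem exists_sign (t : ℝ) (ht : t ≠ 0) : ∃ σ : ℝ, σ * σ = 1 ∧ ∀ r : ℝ, |r| < |t| → |t + r| = |t| + σ * r := by
  rcases lt_or_gt_of_ne ht with h | h
  · refine ⟨-1, by norm_num, fun r hr => ?_⟩
    rw [abs_of_neg h] at hr ⊢
    rw [abs_lt] at hr
    rw [abs_of_neg (by linarith)]
    ring
  · refine ⟨1, by norm_num, fun r hr => ?_⟩
    rw [abs_of_pos h] at hr ⊢
    rw [abs_lt] at hr
    rw [abs_of_pos (by linarith)]
    ring

/-- **HELMHOLTZ EQUATION for the shell transform** off the mirror: `Σᵢ ∂ᵢ² (lfEval ν)(x) = s · lfEval ν x` for `x₀ ≠ 0`. -/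
theorem helmholtz_lfEval (h : IsShellMeasure ν s) {x : E4} (hx : x 0 ≠ 0) :
    (∑ i : Fin 4, iteratedFDeriv ℝ 2 (lfEval ν) x (fun _ => EuclideanSpace.single i (1 : ℝ))) = s * lfEval ν x := by
  have hKx : ContDiffAt ℝ 2 (lfEval ν) x := contDiffAt_lfEval h hx
  have h0 := neg_null_of_shell h
  have hint := h.2.2
  have hcone := h.1
  have hae := IsShellMeasure.ae_cone h
  obtain ⟨t, z, rfl⟩ : ∃ t z, x = timeSpace t z := ⟨x 0, spacePart x, (timeSpace_self x).symm⟩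
  rw [timeSpace_apply_zero] at hx
  obtain ⟨τ, hτdef⟩ : ∃ τ : ℝ, τ = |t| := ⟨_, rfl⟩
  have hτ : 0 < τ := by rw [hτdef]; exact abs_pos.2 hx
  obtain ⟨σ, hσ, hsign⟩ := exists_sign t hx
  rw [← hτdef] at hsign
  -- integrability of the weighted density
  have hdom : ∀ m : ℕ, Integrable (fun p : ℝ × E3 => p.1 ^ m * Real.exp (-(τ * p.1)) * (1 : ℝ)) ν := fun m =>
    integrable_pow_mul_exp_mul ν h0 hint (fun _ => (1 : ℝ)) measurable_const (C := 1) (fun _ => by simp) hτ m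
  have h2 : Integrable (fun p : ℝ × E3 => ‖p.2‖ ^ 2 * Real.exp (-(τ * p.1))) ν := by
    refine ((hdom 2).mono' (by fun_prop : Measurable fun p : ℝ × E3 => ‖p.2‖ ^ 2 * Real.exp (-(τ * p.1))).aestronglyMeasurable ?_)
    filter_upwards [hae] with p hp
    rw [Real.norm_eq_abs, abs_mul, abs_of_pos (Real.exp_pos _), abs_pow, abs_norm, mul_one]
    exact mul_le_mul_of_nonneg_right (pow_le_pow_left₀ (norm_nonneg _) hp.2 2) (Real.exp_pos _).le
  have hneg_sin : ∀ u, HasDerivAt Real.cos (-Real.sin u) u := Real.hasDerivAt_cos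
  have hneg_cos : ∀ u, HasDerivAt (fun u => -Real.sin u) (-Real.cos u) u := fun u => (Real.hasDerivAt_sin u).neg
  have hcm : Measurable fun q : E3 => Real.cos (inner ℝ q z) := by fun_prop
  have hcb : ∀ q : E3, |Real.cos (inner ℝ q z)| ≤ 1 := fun q => Real.abs_cos_le_one _
  -- TIME direction
  have htime : iteratedFDeriv ℝ 2 (lfEval ν) (timeSpace t z) (fun _ => EuclideanSpace.single (0 : Fin 4) (1 : ℝ))
      = ∫ p : ℝ × E3, p.1 ^ 2 * Real.exp (-(τ * p.1)) * Real.cos (inner ℝ p.2 z) ∂ν := by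
    have hΦ : ∀ (n : ℕ) (τ' : ℝ), 0 < τ' → HasDerivAt
        (fun τ' : ℝ => ∫ p : ℝ × E3, p.1 ^ n * Real.exp (-(τ' * p.1)) * Real.cos (inner ℝ p.2 z) ∂ν)
        (-∫ p : ℝ × E3, p.1 ^ (n + 1) * Real.exp (-(τ' * p.1)) * Real.cos (inner ℝ p.2 z) ∂ν) τ' :=
      fun n τ' hτ' => hasDerivAt_integral_pow_mul_exp_mul ν h0 hint _ hcm hcb n hτ'
    have hline : ∀ r : ℝ, HasDerivAt (fun r : ℝ => τ + σ * r) σ r := fun r => by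
      simpa using ((hasDerivAt_id r).const_mul σ).const_add τ
    refine iteratedFDeriv_two_eq_of_line hKx
      (φ' := fun r => (-σ) * ∫ p : ℝ × E3, p.1 ^ 1 * Real.exp (-((τ + σ * r) * p.1)) * Real.cos (inner ℝ p.2 z) ∂ν) ?_ ?_
    · -- first derivative along the line, for `|r| < τ`
      have hev : ∀ᶠ r in 𝓝 (0 : ℝ), |r| < τ := by
        have : Metric.ball (0 : ℝ) τ ∈ 𝓝 (0 : ℝ) := Metric.ball_mem_nhds 0 hτ
        filter_upwards [this] with r hr
        rwa [Metric.mem_ball, dist_zero_right, Real.norm_eq_abs] at hr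
      filter_upwards [hev] with r hr
      have hτr : 0 < τ + σ * r := by
        rw [← hsign r hr]
        exact abs_pos.2 (by rw [abs_lt] at hr; intro h0'; rw [hτdef] at hr; rcases lt_or_gt_of_ne hx with h' | h' <;>
          [rw [abs_of_neg h'] at hr; rw [abs_of_pos h'] at hr] <;> linarith)
      -- `lfEval (x + r' e₀) = Φ₀(τ + σ r')` near `r`
      have hloc : ∀ᶠ r' in 𝓝 r, lfEval ν (timeSpace t z + r' • EuclideanSpace.single (0 : Fin 4) (1 : ℝ))
          = ∫ p : ℝ × E3, p.1 ^ 0 * Real.exp (-((τ + σ * r') * p.1)) * Real.cos (inner ℝ p.2 z) ∂ν := by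
        have hev' : ∀ᶠ r' in 𝓝 r, |r'| < τ := (continuous_abs.tendsto r).eventually (gt_mem_nhds hr)
        filter_upwards [hev'] with r' hr'
        rw [timeSpace_add_smul_zero, lfEval_timeSpace, hsign r' hr']
        simp
      have hd : HasDerivAt (fun r' : ℝ => ∫ p : ℝ × E3, p.1 ^ 0 * Real.exp (-((τ + σ * r') * p.1)) * Real.cos (inner ℝ p.2 z) ∂ν)
          (-(∫ p : ℝ × E3, p.1 ^ 1 * Real.exp (-((τ + σ * r) * p.1)) * Real.cos (inner ℝ p.2 z) ∂ν) * σ) r := by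
        have hc := (hΦ 0 (τ + σ * r) hτr).comp r (hline r)
        simpa [Function.comp_def] using hc
      exact (hd.congr_of_eventuallyEq hloc).congr_deriv (by ring)
    · -- second derivative at `0`
      have hτ0 : 0 < τ + σ * 0 := by simpa using hτ
      have hd : HasDerivAt (fun r : ℝ => ∫ p : ℝ × E3, p.1 ^ 1 * Real.exp (-((τ + σ * r) * p.1)) * Real.cos (inner ℝ p.2 z) ∂ν)
          (-(∫ p : ℝ × E3, p.1 ^ 2 * Real.exp (-((τ + σ * 0) * p.1)) * Real.cos (inner ℝ p.2 z) ∂ν) * σ) 0 := by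
        have hc := (hΦ 1 (τ + σ * 0) hτ0).comp (0 : ℝ) (hline 0)
        simpa [Function.comp_def] using hc
      have h2' := hd.const_mul (-σ)
      simp only [mul_zero, add_zero, pow_one] at h2' ⊢
      refine h2'.congr_deriv ?_
      rw [show -σ * (-(∫ p : ℝ × E3, p.1 ^ 2 * Real.exp (-(τ * p.1)) * Real.cos (inner ℝ p.2 z) ∂ν) * σ)
        = (∫ p : ℝ × E3, p.1 ^ 2 * Real.exp (-(τ * p.1)) * Real.cos (inner ℝ p.2 z) ∂ν) * (σ * σ) by ring, hσ, mul_one]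
  -- SPACE directions
  have hrepr : ∀ z' : E3, lfEval ν (timeSpace t z') = ∫ p, Real.exp (-(τ * p.1)) * Real.cos (inner ℝ p.2 z') ∂ν := fun z' => by
    rw [lfEval_timeSpace, hτdef]
  have hspace : ∀ j : Fin 3, iteratedFDeriv ℝ 2 (lfEval ν) (timeSpace t z) (fun _ => EuclideanSpace.single j.succ (1 : ℝ))
      = -∫ p : ℝ × E3, Real.exp (-(τ * p.1)) * p.2 j ^ 2 * Real.cos (inner ℝ p.2 z) ∂ν := by
    intro j
    have hd2 := fun s₀ => (hasDerivAt_integral_spatial ν h0 hint hcone hτ z j 1 (fun u => -Real.sin u) (fun u => -Real.cos u)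
      hneg_cos (Real.continuous_sin.neg) (Real.continuous_cos.neg) (fun u => by rw [abs_neg]; exact Real.abs_sin_le_one u)
      (fun u => by rw [abs_neg]; exact Real.abs_cos_le_one u) s₀).2
    refine iteratedFDeriv_two_eq_of_line hKx
      (φ' := fun s => ∫ p : ℝ × E3, Real.exp (-(τ * p.1)) * p.2 j ^ (0 + 1) * -Real.sin (inner ℝ p.2 z + s * p.2 j) ∂ν) ?_ ?_
    · refine Eventually.of_forall fun s => ?_
      have hloc : ∀ r : ℝ, lfEval ν (timeSpace t z + r • EuclideanSpace.single j.succ (1 : ℝ))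
          = ∫ p : ℝ × E3, Real.exp (-(τ * p.1)) * p.2 j ^ 0 * Real.cos (inner ℝ p.2 z + r * p.2 j) ∂ν := by
        intro r
        rw [timeSpace_add_smul_succ, hrepr]
        refine integral_congr_ae (Eventually.of_forall fun p => ?_)
        dsimp only
        rw [inner_add_smul_single, pow_zero, mul_one]
      have h := (hasDerivAt_integral_spatial ν h0 hint hcone hτ z j 0 Real.cos (fun u => -Real.sin u) hneg_sin
        Real.continuous_cos (Real.continuous_sin.neg) (fun u => Real.abs_cos_le_one u)
        (fun u => by rw [abs_neg]; exact Real.abs_sin_le_one u) s).2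
      exact h.congr_of_eventuallyEq (Eventually.of_forall fun r => hloc r)
    · have h := hd2 0
      simp only [zero_add, pow_one] at h ⊢
      have e : (∫ p : ℝ × E3, Real.exp (-(τ * p.1)) * p.2 j ^ (1 + 1) * -Real.cos (inner ℝ p.2 z + 0 * p.2 j) ∂ν)
          = -∫ p : ℝ × E3, Real.exp (-(τ * p.1)) * p.2 j ^ 2 * Real.cos (inner ℝ p.2 z) ∂ν := by
        rw [← integral_neg]
        refine integral_congr_ae (Eventually.of_forall fun p => ?_)
        dsimp only
        rw [zero_mul, add_zero]
        ring
      rw [← e]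
      exact h
  -- SUM
  have I1 : Integrable (fun p : ℝ × E3 => p.1 ^ 2 * Real.exp (-(τ * p.1)) * Real.cos (inner ℝ p.2 z)) ν :=
    integrable_pow_mul_exp_mul ν h0 hint _ hcm hcb hτ 2
  have I2 : Integrable (fun p : ℝ × E3 => ‖p.2‖ ^ 2 * Real.exp (-(τ * p.1)) * Real.cos (inner ℝ p.2 z)) ν := by
    refine h2.mono' ((by fun_prop : Measurable fun p : ℝ × E3 => ‖p.2‖ ^ 2 * Real.exp (-(τ * p.1)) * Real.cos (inner ℝ p.2 z))
      |>.aestronglyMeasurable) (Eventually.of_forall fun p => ?_)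
    rw [Real.norm_eq_abs, abs_mul, abs_mul, abs_of_pos (Real.exp_pos _), abs_pow, abs_norm]
    exact mul_le_of_le_one_right (by positivity) (hcb _)
  have I3 : ∀ j : Fin 3, Integrable (fun p : ℝ × E3 => Real.exp (-(τ * p.1)) * p.2 j ^ 2 * Real.cos (inner ℝ p.2 z)) ν := by
    intro j
    have h := (hasDerivAt_integral_spatial ν h0 hint hcone hτ z j 2 Real.cos (fun u => -Real.sin u) hneg_sin
      Real.continuous_cos (Real.continuous_sin.neg) (fun u => Real.abs_cos_le_one u)
      (fun u => by rw [abs_neg]; exact Real.abs_sin_le_one u) 0).1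
    refine h.congr (Eventually.of_forall fun p => ?_)
    simp
  have hnorm : ∀ q : E3, ‖q‖ ^ 2 = ∑ j : Fin 3, q j ^ 2 := fun q => by
    rw [EuclideanSpace.norm_eq, Real.sq_sqrt (Finset.sum_nonneg fun i _ => by positivity)]
    exact Finset.sum_congr rfl fun i _ => by rw [Real.norm_eq_abs, sq_abs]
  have hsplit : ∫ p : ℝ × E3, ‖p.2‖ ^ 2 * Real.exp (-(τ * p.1)) * Real.cos (inner ℝ p.2 z) ∂ν
      = ∑ j : Fin 3, ∫ p : ℝ × E3, Real.exp (-(τ * p.1)) * p.2 j ^ 2 * Real.cos (inner ℝ p.2 z) ∂ν := by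
    rw [← integral_finsetSum _ (fun j _ => I3 j)]
    refine integral_congr_ae (Eventually.of_forall fun p => ?_)
    dsimp only
    rw [hnorm p.2, Finset.sum_mul, Finset.sum_mul]
    exact Finset.sum_congr rfl fun j _ => by ring
  rw [Fin.sum_univ_succ, htime]
  simp_rw [hspace]
  rw [Finset.sum_neg_distrib, ← hsplit, ← sub_eq_add_neg, ← integral_sub I1 I2, hrepr, ← integral_const_mul]
  refine integral_congr_ae ?_
  filter_upwards [ae_massSq_of_shell h] with p hp
  rw [← hp]
  ring

end Summit.QuantumFields.YangMills.Theorems.F4SubCurvatureDoorShellLFHelmholtz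

end
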